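import Mathlib.Probability.Independence.Integration
import Mathlib.MeasureTheory.Integral.DominatedConvergence
import Mathlib.Analysis.SpecialFunctions.Exponential
import Mathlib.Analysis.Complex.Exponential
import HarnessLib

/-!
# Reflection positivity for real-valued lattice spins: the Cauchy–Schwarz inequality for exponential kernels

Proofs-only file (topic `Literature/MathematicalPhysics/QuantumLattice`; theorems only, no definition,
no named fact). First step of the port of Gaussian domination / the infrared bound
(Fröhlich–Simon–Spencer 1976; Fröhlich–Israel–Lieb–Simon 1978; Friedli–Velenik 2017, §10.5.3,
Lemma 10.28 and Prop. 10.27) from the tree's Ising version (`GaussianDominationProofs.lean`,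
finite sums over `{±1}` configurations) to **real-valued spins with an arbitrary single-site
probability measure** `ν` on `ℝ` (the lattice `φ⁴` case: `ν ∝ e^{-gu⁴-κu²} du`), i.e. to the
product probability measure `μ = ⊗_{x ∈ V} ν` on `V → ℝ`.

For an involution `θ` of the finite index set `V` exchanging a half `P` with its complement:

* `indepFun_dependsOn_reflect`, `integral_mul_comp_reflect` — a function of the `P`-coordinates
  and the reflection `g(φ ∘ θ)` of another one are independent under `μ`, so
  `∫ f(φ) g(φ∘θ) dμ = ∫ f dμ ∫ g dμ` (`integral_comp_reflect`: `μ` is `θ`-invariant);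
* `integral_reflect_expKernel_sq_le` — **Lemma 10.28 for real spins**: for `β ≥ 0`, functions
  `Φ, Ψ` and features `p_c, q_c` (`c ∈ C` finite) of the `P`-coordinates,
  `(∫ Φ(φ)Ψ(φθ) e^{β∑_c p_c(φ)q_c(φθ)} dμ)² ≤ (∫ ΦΦ^θ e^{β∑pp^θ} dμ)(∫ ΨΨ^θ e^{β∑qq^θ} dμ)`,
  proved as in Friedli–Velenik (10.44): expand the exponential — here through its PARTIAL sums,
  `∫ ΦΨ^θ e_N(βS) = ∑_{n<N} βⁿ/n! ∑_{v ∈ Cⁿ} (∫Φ∏p_{v_m})(∫Ψ∏q_{v_m})` (independence), so that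
  `A_N - 2tM_N + t²B_N = ∑ βⁿ/n! ∑_v (a - tb)² ≥ 0`; then `N → ∞` by dominated convergence
  (domination `|Φ|e^{(β/2)∑p²} · |Ψ^θ|e^{(β/2)∑(q^θ)²} ≤ K_Φ K_Ψ`) and the discriminant.

## References

* S. Friedli, Y. Velenik, *Statistical Mechanics of Lattice Systems* (CUP 2017), §10.5.3,
  Lemma 10.28 and its proof, (10.44) [FriedliVelenik2017].
* J. Fröhlich, R. Israel, E. H. Lieb, B. Simon, Comm. Math. Phys. 62 (1978), §2 (reflection
  positivity of product measures under reflections through bonds) [FILS1978].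
-/

noncomputable section

open MeasureTheory ProbabilityTheory Filter Topology Finset

namespace Literature.MathematicalPhysics.QuantumLattice

section Reflect

variable {V : Type*} [Fintype V] [DecidableEq V] (ν : Measure ℝ) [IsProbabilityMeasure ν]
  (θ : V ≃ V) (P : Finset V)

omit [Fintype V] in
/-- The zero extension of a half configuration `ψ : P → ℝ` to `V`. Reading a function that
depends only on the `P`-coordinates through it reproduces the function. [folklore] -/
theorem apply_extend_restrict {β : Type*} {f : (V → ℝ) → β} (hf : DependsOn f (P : Set V))
    (φ : V → ℝ) :
    f (fun x => if hx : x ∈ P then (fun i : P => φ i) ⟨x, hx⟩ else 0) = f φ :=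
  hf fun x hx => by simp [Finset.mem_coe.1 hx]

omit [Fintype V] in
/-- The zero-extension map `(P → ℝ) → (V → ℝ)` is measurable. [folklore] -/
theorem measurable_extendHalf :
    Measurable fun (ψ : P → ℝ) (x : V) => if hx : x ∈ P then ψ ⟨x, hx⟩ else 0 := by
  refine measurable_pi_lambda _ fun x => ?_
  by_cases hx : x ∈ P
  · simp only [hx, dif_pos]
    exact measurable_pi_apply _
  · simp only [hx, dif_neg, not_false_eq_true]
    exact measurable_const

/-- **A `P`-measurable function and the reflection of another one are independent** under the
product measure, when `θ` exchanges `P` and its complement (Fröhlich–Israel–Lieb–Simon 1978, §2: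
reflection positivity of product measures for reflections through bonds). [cite: FILS1978, §2] -/
theorem indepFun_dependsOn_reflect (hP : ∀ x, x ∈ P ↔ θ x ∉ P) {f g : (V → ℝ) → ℝ}
    (hfm : Measurable f) (hgm : Measurable g) (hf : DependsOn f (P : Set V))
    (hg : DependsOn g (P : Set V)) :
    IndepFun f (fun φ => g (fun x => φ (θ x))) (Measure.pi fun _ : V => ν) := by
  classical
  -- the coordinate blocks `P` and `Pᶜ` are independent
  have hind : IndepFun (fun (φ : V → ℝ) (i : P) => φ i) (fun (φ : V → ℝ) (i : (Pᶜ : Finset V)) => φ i)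
      (Measure.pi fun _ : V => ν) := by
    have h : iIndepFun (fun i (φ : V → ℝ) => φ i) (Measure.pi fun _ : V => ν) :=
      iIndepFun_pi (X := fun _ : V => @id ℝ) fun _ => aemeasurable_id
    exact h.indepFun_finset P Pᶜ disjoint_compl_right fun i => measurable_pi_apply i
  -- `f` through the `P`-block, `g ∘ θ*` through the `Pᶜ`-block
  set f' : (P → ℝ) → ℝ := fun ψ => f (fun x => if hx : x ∈ P then ψ ⟨x, hx⟩ else 0) with hf'
  set g'' : ((Pᶜ : Finset V) → ℝ) → ℝ := fun χ =>
    g (fun x => if hx : x ∈ P then χ ⟨θ x, Finset.mem_compl.2 ((hP x).1 hx)⟩ else 0) with hg''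
  have hf'm : Measurable f' := hfm.comp (measurable_extendHalf P)
  have hg''m : Measurable g'' := by
    refine hgm.comp (measurable_pi_lambda _ fun x => ?_)
    by_cases hx : x ∈ P
    · simp only [hx, dif_pos]
      exact measurable_pi_apply _
    · simp only [hx, dif_neg, not_false_eq_true]
      exact measurable_const
  have h1 : f = f' ∘ fun (φ : V → ℝ) (i : P) => φ i := by
    funext φ
    exact (apply_extend_restrict P hf φ).symm
  have h2 : (fun φ : V → ℝ => g (fun x => φ (θ x))) = g'' ∘ fun (φ : V → ℝ) (i : (Pᶜ : Finset V)) => φ i := by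
    funext φ
    simp only [Function.comp_apply, hg'']
    refine hg fun x hx => ?_
    simp [Finset.mem_coe.1 hx]
  rw [h1, h2]
  exact hind.comp hf'm hg''m

omit [DecidableEq V] in
/-- **`θ`-invariance of the product measure**: `∫ g(φ ∘ θ) dμ = ∫ g dμ`. [folklore] -/
theorem integral_comp_reflect (g : (V → ℝ) → ℝ) :
    ∫ φ, g (fun x => φ (θ x)) ∂(Measure.pi fun _ : V => ν) =
      ∫ φ, g φ ∂(Measure.pi fun _ : V => ν) := by
  have h := measurePreserving_piCongrLeft (fun _ : V => ν) θ.symm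
  have hfun : ∀ φ : V → ℝ,
      (MeasurableEquiv.piCongrLeft (fun _ : V => ℝ) θ.symm) φ = fun x => φ (θ x) := by
    intro φ
    funext x
    rw [MeasurableEquiv.coe_piCongrLeft, Equiv.piCongrLeft_apply, eq_rec_constant,
      Equiv.symm_symm]
  calc ∫ φ, g (fun x => φ (θ x)) ∂(Measure.pi fun _ : V => ν)
      = ∫ φ, g ((MeasurableEquiv.piCongrLeft (fun _ : V => ℝ) θ.symm) φ) ∂(Measure.pi fun _ : V => ν) :=
        integral_congr_ae (Eventually.of_forall fun φ => by simp only [hfun])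
    _ = ∫ φ, g φ ∂(Measure.pi fun _ : V => ν) := h.integral_comp' g

omit [DecidableEq V] in
/-- Integrability is invariant under the reflection of configurations. [folklore] -/
theorem integrable_comp_reflect_iff (g : (V → ℝ) → ℝ) :
    Integrable (fun φ : V → ℝ => g (fun x => φ (θ x))) (Measure.pi fun _ : V => ν) ↔
      Integrable g (Measure.pi fun _ : V => ν) := by
  have h := measurePreserving_piCongrLeft (fun _ : V => ν) θ.symm
  have hfun : (fun φ : V → ℝ => g (fun x => φ (θ x))) =
      g ∘ (MeasurableEquiv.piCongrLeft (fun _ : V => ℝ) θ.symm) := by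
    funext φ
    simp only [Function.comp_apply]
    congr 1
    funext x
    rw [MeasurableEquiv.coe_piCongrLeft, Equiv.piCongrLeft_apply, eq_rec_constant,
      Equiv.symm_symm]
  rw [hfun]
  exact h.integrable_comp_emb (MeasurableEquiv.measurableEmbedding _)

/-- **Independence of the two halves**: `∫ f(φ) g(φ∘θ) dμ = ∫ f dμ · ∫ g dμ` for measurable `f, g`
depending only on the `P`-coordinates. [cite: FILS1978, §2] -/
theorem integral_mul_comp_reflect (hP : ∀ x, x ∈ P ↔ θ x ∉ P) {f g : (V → ℝ) → ℝ}
    (hfm : Measurable f) (hgm : Measurable g) (hf : DependsOn f (P : Set V))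
    (hg : DependsOn g (P : Set V)) :
    ∫ φ, f φ * g (fun x => φ (θ x)) ∂(Measure.pi fun _ : V => ν) =
      (∫ φ, f φ ∂(Measure.pi fun _ : V => ν)) * ∫ φ, g φ ∂(Measure.pi fun _ : V => ν) := by
  have hind := indepFun_dependsOn_reflect ν θ P hP hfm hgm hf hg
  have hgθm : Measurable fun φ : V → ℝ => g (fun x => φ (θ x)) :=
    hgm.comp (measurable_pi_lambda _ fun x => measurable_pi_apply (θ x))
  rw [hind.integral_fun_mul_eq_mul_integral hfm.aestronglyMeasurable hgθm.aestronglyMeasurable,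
    integral_comp_reflect ν θ g]

/-- The product of a `P`-measurable integrable function and the reflection of another one is
integrable. [folklore] -/
theorem integrable_mul_comp_reflect (hP : ∀ x, x ∈ P ↔ θ x ∉ P) {f g : (V → ℝ) → ℝ}
    (hfm : Measurable f) (hgm : Measurable g) (hf : DependsOn f (P : Set V))
    (hg : DependsOn g (P : Set V)) (hfi : Integrable f (Measure.pi fun _ : V => ν))
    (hgi : Integrable g (Measure.pi fun _ : V => ν)) :
    Integrable (fun φ : V → ℝ => f φ * g (fun x => φ (θ x))) (Measure.pi fun _ : V => ν) := by
  have hind := indepFun_dependsOn_reflect ν θ P hP hfm hgm hf hg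
  exact hind.integrable_mul hfi ((integrable_comp_reflect_iff ν θ g).2 hgi)

end Reflect

/-! ### The Cauchy–Schwarz inequality for exponential kernels (Friedli–Velenik 2017, Lemma 10.28) -/

section ExpKernel

variable {V : Type*} [Fintype V] [DecidableEq V] (ν : Measure ℝ) [IsProbabilityMeasure ν]
  (θ : V ≃ V) (P : Finset V) {C : Type*} [Fintype C]

omit [Fintype V] [DecidableEq V] [Fintype C] in
/-- Products of `P`-dependent functions depend on `P`. [folklore] -/
theorem dependsOn_mul_prod {Φ : (V → ℝ) → ℝ} {p : C → (V → ℝ) → ℝ}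
    (hΦP : DependsOn Φ (P : Set V)) (hpP : ∀ c, DependsOn (p c) (P : Set V)) {n : ℕ}
    (v : Fin n → C) : DependsOn (fun φ => Φ φ * ∏ m, p (v m) φ) (P : Set V) := by
  intro φ φ' h
  simp only
  rw [hΦP h]
  congr 1
  exact Finset.prod_congr rfl fun m _ => hpP (v m) h

omit [Fintype V] [DecidableEq V] [Fintype C] in
/-- Products of measurable functions and features are measurable. [folklore] -/
theorem measurable_mul_prod {Φ : (V → ℝ) → ℝ} {p : C → (V → ℝ) → ℝ} (hΦm : Measurable Φ)
    (hpm : ∀ c, Measurable (p c)) {n : ℕ} (v : Fin n → C) :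
    Measurable fun φ => Φ φ * ∏ m, p (v m) φ :=
  hΦm.mul (Finset.measurable_prod _ fun m _ => hpm (v m))

/-- **The partial expansion of the kernel** ((10.44) with a truncated exponential): with
`e_N(s) = ∑_{n<N} sⁿ/n!`,
`∫ Φ(φ) Ψ(φθ) e_N(β∑_c p_c(φ)q_c(φθ)) dμ = ∑_{n<N} βⁿ/n! ∑_{v∈Cⁿ} (∫Φ∏p_{v_m} dμ)(∫Ψ∏q_{v_m} dμ)`
(independence of the two halves term by term). [cite: FriedliVelenik2017, Lemma 10.28, eq. (10.44)] -/
theorem integral_expKernel_partial_eq (hP : ∀ x, x ∈ P ↔ θ x ∉ P) (β : ℝ)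
    {Φ Ψ : (V → ℝ) → ℝ} {p q : C → (V → ℝ) → ℝ} (hΦm : Measurable Φ) (hΨm : Measurable Ψ)
    (hpm : ∀ c, Measurable (p c)) (hqm : ∀ c, Measurable (q c))
    (hΦP : DependsOn Φ (P : Set V)) (hΨP : DependsOn Ψ (P : Set V))
    (hpP : ∀ c, DependsOn (p c) (P : Set V)) (hqP : ∀ c, DependsOn (q c) (P : Set V))
    (hΦi : ∀ (n : ℕ) (v : Fin n → C), Integrable (fun φ => Φ φ * ∏ m, p (v m) φ) (Measure.pi fun _ : V => ν))
    (hΨi : ∀ (n : ℕ) (v : Fin n → C), Integrable (fun φ => Ψ φ * ∏ m, q (v m) φ) (Measure.pi fun _ : V => ν))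
    (N : ℕ) :
    ∫ φ, Φ φ * Ψ (fun x => φ (θ x)) *
        ∑ n ∈ Finset.range N, (β * ∑ c, p c φ * q c (fun x => φ (θ x))) ^ n / (n.factorial : ℝ)
          ∂(Measure.pi fun _ : V => ν) =
      ∑ n ∈ Finset.range N, β ^ n / (n.factorial : ℝ) * ∑ v : Fin n → C,
        (∫ φ, Φ φ * ∏ m, p (v m) φ ∂(Measure.pi fun _ : V => ν)) *
          ∫ φ, Ψ φ * ∏ m, q (v m) φ ∂(Measure.pi fun _ : V => ν) := by
  set μ : Measure (V → ℝ) := Measure.pi fun _ : V => ν with hμ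
  -- each term: a `P`-function times the reflection of a `P`-function
  have hterm : ∀ (n : ℕ) (v : Fin n → C) (φ : V → ℝ),
      Φ φ * Ψ (fun x => φ (θ x)) * ((∏ m, p (v m) φ) * ∏ m, q (v m) (fun x => φ (θ x))) =
        (Φ φ * ∏ m, p (v m) φ) * ((fun ψ => Ψ ψ * ∏ m, q (v m) ψ) fun x => φ (θ x)) := by
    intro n v φ; ring
  have hint : ∀ (n : ℕ) (v : Fin n → C), Integrable (fun φ => Φ φ * Ψ (fun x => φ (θ x)) *
      ((∏ m, p (v m) φ) * ∏ m, q (v m) (fun x => φ (θ x)))) μ := by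
    intro n v
    simp_rw [hterm n v]
    exact integrable_mul_comp_reflect ν θ P hP (measurable_mul_prod hΦm hpm v)
      (measurable_mul_prod hΨm hqm v) (dependsOn_mul_prod P hΦP hpP v)
      (dependsOn_mul_prod P hΨP hqP v) (hΦi n v) (hΨi n v)
  -- expand the power and distribute
  have hexp : ∀ φ : V → ℝ, Φ φ * Ψ (fun x => φ (θ x)) *
      ∑ n ∈ Finset.range N, (β * ∑ c, p c φ * q c (fun x => φ (θ x))) ^ n / (n.factorial : ℝ) =
      ∑ n ∈ Finset.range N, ∑ v : Fin n → C, β ^ n / (n.factorial : ℝ) *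
        (Φ φ * Ψ (fun x => φ (θ x)) * ((∏ m, p (v m) φ) * ∏ m, q (v m) (fun x => φ (θ x)))) := by
    intro φ
    rw [Finset.mul_sum]
    refine Finset.sum_congr rfl fun n _ => ?_
    rw [mul_pow, Fintype.sum_pow, Finset.mul_sum, Finset.sum_div, Finset.mul_sum]
    refine Finset.sum_congr rfl fun v _ => ?_
    rw [Finset.prod_mul_distrib]
    ring
  simp_rw [hexp]
  rw [integral_finsetSum _ fun n _ => integrable_finsetSum _ fun v _ => (hint n v).const_mul _]
  refine Finset.sum_congr rfl fun n _ => ?_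
  rw [integral_finsetSum _ fun v _ => (hint n v).const_mul _, Finset.mul_sum]
  refine Finset.sum_congr rfl fun v _ => ?_
  rw [integral_const_mul]
  congr 1
  simp_rw [hterm n v]
  exact integral_mul_comp_reflect ν θ P hP (measurable_mul_prod hΦm hpm v)
    (measurable_mul_prod hΨm hqm v) (dependsOn_mul_prod P hΦP hpP v) (dependsOn_mul_prod P hΨP hqP v)

omit [DecidableEq V] in
/-- `|e_N(s)| ≤ e^{|s|}` for the truncated exponential. [folklore] -/
theorem abs_sum_range_pow_div_factorial_le (s : ℝ) (N : ℕ) :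
    |∑ n ∈ Finset.range N, s ^ n / (n.factorial : ℝ)| ≤ Real.exp |s| := by
  refine (Finset.abs_sum_le_sum_abs _ _).trans ?_
  have h : ∀ n ∈ Finset.range N, |s ^ n / (n.factorial : ℝ)| = |s| ^ n / (n.factorial : ℝ) := by
    intro n _
    rw [abs_div, abs_pow, Nat.abs_cast]
  rw [Finset.sum_congr rfl h]
  exact Real.sum_le_exp_of_nonneg (abs_nonneg s) N

omit [DecidableEq V] in
/-- **Convergence of the truncated kernels** (dominated convergence): for bounded dominations
`|Φ|e^{(β/2)∑p²} ≤ K_Φ`, `|Ψ|e^{(β/2)∑q²} ≤ K_Ψ` (`β ≥ 0`),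
`∫ ΦΨ^θ e_N(βS) dμ → ∫ ΦΨ^θ e^{βS} dμ`, `S = ∑_c p_c(φ)q_c(φθ)`. [folklore] -/
theorem tendsto_integral_expKernel_partial {β : ℝ} (hβ : 0 ≤ β)
    {Φ Ψ : (V → ℝ) → ℝ} {p q : C → (V → ℝ) → ℝ} (hΦm : Measurable Φ) (hΨm : Measurable Ψ)
    (hpm : ∀ c, Measurable (p c)) (hqm : ∀ c, Measurable (q c))
    {KΦ KΨ : ℝ} (hKΦ : ∀ φ, |Φ φ| * Real.exp (β / 2 * ∑ c, p c φ ^ 2) ≤ KΦ)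
    (hKΨ : ∀ φ, |Ψ φ| * Real.exp (β / 2 * ∑ c, q c φ ^ 2) ≤ KΨ) :
    Tendsto (fun N => ∫ φ, Φ φ * Ψ (fun x => φ (θ x)) *
        ∑ n ∈ Finset.range N, (β * ∑ c, p c φ * q c (fun x => φ (θ x))) ^ n / (n.factorial : ℝ)
          ∂(Measure.pi fun _ : V => ν)) atTop
      (𝓝 (∫ φ, Φ φ * Ψ (fun x => φ (θ x)) *
        Real.exp (β * ∑ c, p c φ * q c (fun x => φ (θ x))) ∂(Measure.pi fun _ : V => ν))) := by
  set μ : Measure (V → ℝ) := Measure.pi fun _ : V => ν with hμ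
  have hθm : Measurable fun (φ : V → ℝ) (x : V) => φ (θ x) :=
    measurable_pi_lambda _ fun x => measurable_pi_apply (θ x)
  have hSm : Measurable fun φ : V → ℝ => β * ∑ c, p c φ * q c (fun x => φ (θ x)) :=
    (Finset.measurable_sum _ fun c _ => (hpm c).mul ((hqm c).comp hθm)).const_mul β
  refine tendsto_integral_of_dominated_convergence (fun _ => KΦ * KΨ) ?_ (integrable_const _) ?_ ?_
  · intro N
    exact ((hΦm.mul (hΨm.comp hθm)).mul ((Finset.measurable_sum _ fun n _ =>
      (hSm.pow_const n).div_const _))).aestronglyMeasurable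
  · intro N
    refine Eventually.of_forall fun φ => ?_
    rw [Real.norm_eq_abs, abs_mul, abs_mul]
    have hS0 : |∑ c, p c φ * q c (fun x => φ (θ x))| ≤
        ((∑ c, p c φ ^ 2) + ∑ c, q c (fun x => φ (θ x)) ^ 2) / 2 := by
      refine (Finset.abs_sum_le_sum_abs _ _).trans ?_
      rw [le_div_iff₀ (by norm_num : (0:ℝ) < 2), ← Finset.sum_add_distrib, Finset.sum_mul]
      refine Finset.sum_le_sum fun c _ => ?_
      rw [abs_mul]
      nlinarith [sq_nonneg (|p c φ| - |q c (fun x => φ (θ x))|), sq_abs (p c φ),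
        sq_abs (q c (fun x => φ (θ x)))]
    have hS : |β * ∑ c, p c φ * q c (fun x => φ (θ x))| ≤
        β / 2 * ∑ c, p c φ ^ 2 + β / 2 * ∑ c, q c (fun x => φ (θ x)) ^ 2 := by
      rw [abs_mul, abs_of_nonneg hβ]
      calc β * |∑ c, p c φ * q c (fun x => φ (θ x))|
          ≤ β * (((∑ c, p c φ ^ 2) + ∑ c, q c (fun x => φ (θ x)) ^ 2) / 2) :=
            mul_le_mul_of_nonneg_left hS0 hβ
        _ = _ := by ring
    have h1 := abs_sum_range_pow_div_factorial_le (β * ∑ c, p c φ * q c (fun x => φ (θ x))) N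
    have h2 := hKΦ φ
    have h3 := hKΨ (fun x => φ (θ x))
    have hE : Real.exp |β * ∑ c, p c φ * q c (fun x => φ (θ x))| ≤
        Real.exp (β / 2 * ∑ c, p c φ ^ 2) * Real.exp (β / 2 * ∑ c, q c (fun x => φ (θ x)) ^ 2) := by
      rw [← Real.exp_add]
      exact Real.exp_le_exp.2 hS
    calc |Φ φ| * |Ψ (fun x => φ (θ x))| *
          |∑ n ∈ Finset.range N, (β * ∑ c, p c φ * q c (fun x => φ (θ x))) ^ n / (n.factorial : ℝ)|
        ≤ |Φ φ| * |Ψ (fun x => φ (θ x))| * (Real.exp (β / 2 * ∑ c, p c φ ^ 2) *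
            Real.exp (β / 2 * ∑ c, q c (fun x => φ (θ x)) ^ 2)) :=
          mul_le_mul_of_nonneg_left (h1.trans hE) (mul_nonneg (abs_nonneg _) (abs_nonneg _))
      _ = (|Φ φ| * Real.exp (β / 2 * ∑ c, p c φ ^ 2)) *
            (|Ψ (fun x => φ (θ x))| * Real.exp (β / 2 * ∑ c, q c (fun x => φ (θ x)) ^ 2)) := by ring
      _ ≤ KΦ * KΨ := mul_le_mul h2 h3 (mul_nonneg (abs_nonneg _) (Real.exp_nonneg _))
          ((mul_nonneg (abs_nonneg _) (Real.exp_nonneg _)).trans h2)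
  · refine Eventually.of_forall fun φ => ?_
    refine Tendsto.const_mul _ ?_
    have h : HasSum (fun n : ℕ => (β * ∑ c, p c φ * q c (fun x => φ (θ x))) ^ n / (n.factorial : ℝ))
        (Real.exp (β * ∑ c, p c φ * q c (fun x => φ (θ x)))) := by
      rw [Real.exp_eq_exp_ℝ]
      exact NormedSpace.expSeries_div_hasSum_exp _
    exact h.tendsto_sum_nat

/-- **Lemma 10.28 for real-valued spins (reflection positivity of the product measure in
Cauchy–Schwarz form).** For the product probability measure `μ = ⊗_V ν`, an involution `θ`
exchanging the half `P` and its complement, `β ≥ 0`, measurable `Φ, Ψ` and features `p_c, q_c`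
depending only on the `P`-coordinates, with integrable monomials `Φ∏p_{v_m}`, `Ψ∏q_{v_m}` and
bounded dominations `|Φ|e^{(β/2)∑p²} ≤ K_Φ`, `|Ψ|e^{(β/2)∑q²} ≤ K_Ψ`:
`(∫ Φ(φ)Ψ(φθ)e^{β∑_c p_c(φ)q_c(φθ)} dμ)² ≤ (∫ ΦΦ^θ e^{β∑pp^θ} dμ)(∫ ΨΨ^θ e^{β∑qq^θ} dμ)`.
[cite: FriedliVelenik2017, Lemma 10.28] -/
theorem integral_reflect_expKernel_sq_le (hP : ∀ x, x ∈ P ↔ θ x ∉ P) {β : ℝ} (hβ : 0 ≤ β)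
    {Φ Ψ : (V → ℝ) → ℝ} {p q : C → (V → ℝ) → ℝ} (hΦm : Measurable Φ) (hΨm : Measurable Ψ)
    (hpm : ∀ c, Measurable (p c)) (hqm : ∀ c, Measurable (q c))
    (hΦP : DependsOn Φ (P : Set V)) (hΨP : DependsOn Ψ (P : Set V))
    (hpP : ∀ c, DependsOn (p c) (P : Set V)) (hqP : ∀ c, DependsOn (q c) (P : Set V))
    (hΦi : ∀ (n : ℕ) (v : Fin n → C), Integrable (fun φ => Φ φ * ∏ m, p (v m) φ) (Measure.pi fun _ : V => ν))
    (hΨi : ∀ (n : ℕ) (v : Fin n → C), Integrable (fun φ => Ψ φ * ∏ m, q (v m) φ) (Measure.pi fun _ : V => ν))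
    {KΦ KΨ : ℝ} (hKΦ : ∀ φ, |Φ φ| * Real.exp (β / 2 * ∑ c, p c φ ^ 2) ≤ KΦ)
    (hKΨ : ∀ φ, |Ψ φ| * Real.exp (β / 2 * ∑ c, q c φ ^ 2) ≤ KΨ) :
    (∫ φ, Φ φ * Ψ (fun x => φ (θ x)) *
        Real.exp (β * ∑ c, p c φ * q c (fun x => φ (θ x))) ∂(Measure.pi fun _ : V => ν)) ^ 2 ≤
      (∫ φ, Φ φ * Φ (fun x => φ (θ x)) *
          Real.exp (β * ∑ c, p c φ * p c (fun x => φ (θ x))) ∂(Measure.pi fun _ : V => ν)) *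
        ∫ φ, Ψ φ * Ψ (fun x => φ (θ x)) *
          Real.exp (β * ∑ c, q c φ * q c (fun x => φ (θ x))) ∂(Measure.pi fun _ : V => ν) := by
  set μ : Measure (V → ℝ) := Measure.pi fun _ : V => ν with hμ
  -- the expansion coefficients
  set a : (n : ℕ) → (Fin n → C) → ℝ := fun n v => ∫ φ, Φ φ * ∏ m, p (v m) φ ∂μ with ha
  set b : (n : ℕ) → (Fin n → C) → ℝ := fun n v => ∫ φ, Ψ φ * ∏ m, q (v m) φ ∂μ with hb
  set cf : ℕ → ℝ := fun n => β ^ n / (n.factorial : ℝ) with hcf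
  have hcf0 : ∀ n, 0 ≤ cf n := fun n => by positivity
  -- the three kernels and their partial sums
  have hM := tendsto_integral_expKernel_partial ν θ hβ hΦm hΨm hpm hqm hKΦ hKΨ
  have hA := tendsto_integral_expKernel_partial ν θ hβ hΦm hΦm hpm hpm hKΦ hKΦ
  have hB := tendsto_integral_expKernel_partial ν θ hβ hΨm hΨm hqm hqm hKΨ hKΨ
  have eM := integral_expKernel_partial_eq ν θ P hP β hΦm hΨm hpm hqm hΦP hΨP hpP hqP hΦi hΨi
  have eA := integral_expKernel_partial_eq ν θ P hP β hΦm hΦm hpm hpm hΦP hΦP hpP hpP hΦi hΦi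
  have eB := integral_expKernel_partial_eq ν θ P hP β hΨm hΨm hqm hqm hΨP hΨP hqP hqP hΨi hΨi
  set M := ∫ φ, Φ φ * Ψ (fun x => φ (θ x)) * Real.exp (β * ∑ c, p c φ * q c (fun x => φ (θ x))) ∂μ
  set A := ∫ φ, Φ φ * Φ (fun x => φ (θ x)) * Real.exp (β * ∑ c, p c φ * p c (fun x => φ (θ x))) ∂μ
  set B := ∫ φ, Ψ φ * Ψ (fun x => φ (θ x)) * Real.exp (β * ∑ c, q c φ * q c (fun x => φ (θ x))) ∂μ
  -- the quadratic polynomial `B t² - 2M t + A ≥ 0`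
  have hquad : ∀ t : ℝ, 0 ≤ B * (t * t) + (-2 * M) * t + A := by
    intro t
    have hlim := (hA.sub (hM.const_mul (2 * t))).add (hB.const_mul (t ^ 2))
    have hnn : ∀ N : ℕ, 0 ≤ (∫ φ, Φ φ * Φ (fun x => φ (θ x)) *
        ∑ n ∈ Finset.range N, (β * ∑ c, p c φ * p c (fun x => φ (θ x))) ^ n / (n.factorial : ℝ) ∂μ) -
        2 * t * (∫ φ, Φ φ * Ψ (fun x => φ (θ x)) *
          ∑ n ∈ Finset.range N, (β * ∑ c, p c φ * q c (fun x => φ (θ x))) ^ n / (n.factorial : ℝ) ∂μ) +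
        t ^ 2 * (∫ φ, Ψ φ * Ψ (fun x => φ (θ x)) *
          ∑ n ∈ Finset.range N, (β * ∑ c, q c φ * q c (fun x => φ (θ x))) ^ n / (n.factorial : ℝ) ∂μ) := by
      intro N
      rw [eA N, eM N, eB N]
      have key : ∑ n ∈ Finset.range N, cf n * ∑ v : Fin n → C, a n v * a n v -
          2 * t * ∑ n ∈ Finset.range N, cf n * ∑ v : Fin n → C, a n v * b n v +
          t ^ 2 * ∑ n ∈ Finset.range N, cf n * ∑ v : Fin n → C, b n v * b n v =
            ∑ n ∈ Finset.range N, cf n * ∑ v : Fin n → C, (a n v - t * b n v) ^ 2 := by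
        rw [Finset.mul_sum, Finset.mul_sum, ← Finset.sum_sub_distrib, ← Finset.sum_add_distrib]
        refine Finset.sum_congr rfl fun n _ => ?_
        rw [show 2 * t * (cf n * ∑ v : Fin n → C, a n v * b n v) = cf n * (2 * t * ∑ v : Fin n → C, a n v * b n v) by ring,
          show t ^ 2 * (cf n * ∑ v : Fin n → C, b n v * b n v) = cf n * (t ^ 2 * ∑ v : Fin n → C, b n v * b n v) by ring,
          ← mul_sub, ← mul_add]
        congr 1
        rw [Finset.mul_sum, Finset.mul_sum, ← Finset.sum_sub_distrib, ← Finset.sum_add_distrib]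
        exact Finset.sum_congr rfl fun v _ => by ring
      have hgoal : 0 ≤ ∑ n ∈ Finset.range N, cf n * ∑ v : Fin n → C, (a n v - t * b n v) ^ 2 :=
        Finset.sum_nonneg fun n _ => mul_nonneg (hcf0 n) (Finset.sum_nonneg fun v _ => sq_nonneg _)
      rw [← key] at hgoal
      simpa only [ha, hb, hcf] using hgoal
    have h := ge_of_tendsto' hlim hnn
    nlinarith [h]
  have hd := discrim_le_zero hquad
  rw [discrim] at hd
  nlinarith [hd]

end ExpKernel

end Literature.MathematicalPhysics.QuantumLattice
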